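import Mathlib.Analysis.Fourier.FourierTransform
import Mathlib.Analysis.Complex.Exponential
import Mathlib.Analysis.Real.Pi.Bounds
import Mathlib.MeasureTheory.Function.L2Space
import Mathlib.MeasureTheory.Measure.Lebesgue.Basic
import Mathlib.MeasureTheory.Function.LocallyIntegrable
import HarnessLib

/-!
# Band energy of time-limited functions, II: `L²[−1,1]`, the exponential vectors and the Fourier transform

Cell `rh-explicit`, seat cc-s2-3 (`HOME/cc-s2-3/CERT-PLAN.md` §7, sub-task E1).  Second of four files proving
`∫_{-1}^{1} |𝓕 f(ξ)|² dξ ≤ 0.9999428 · ‖f‖²` for `f ∈ L²(ℝ)` vanishing off `[−1, 1]`.  This file supplies the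
analysis that instantiates the abstract lemma of file I (`SoninBandEnergyAbstract`) in the Hilbert space
`L²([−1,1]) = Lp ℂ 2 (volume.restrict (Icc (-1) 1))`:

* `inner_toLp_toLp`, `norm_toLp_sq` — the inner product / norm of classes of functions as integrals;
* `fourier_eq_setIntegral_Icc` — for `g = 0` a.e. off `[−1,1]`, `𝓕 g ξ = ∫_{[−1,1]} e^{−2πixξ} g(x) dx`, and
  `inner_expVec_toLp` — this equals `⟪e_ξ, [g]⟫` with `e_ξ(x) = e^{2πixξ}` (so the "band energy"
  `∫_{−1}^{1}|𝓕 g|²` is `∫ |⟪e_ξ, [g]⟫|²`); `norm_expVec_sq` — `‖e_ξ‖² = 2`; `continuous_setIntegral_fourierKernel`;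
* `norm_setIntegral_fourierKernel_sub_taylor_le` — the Taylor step under the integral sign:
  `‖∫_{[−1,1]} e^{−2πixξ} g − Σ_{k<n} ((−2πiξ)^k/k!) ∫_{[−1,1]} x^k g‖ ≤ 2 (2π)^n/n! · ∫_{[−1,1]} ‖g‖` for `|ξ| ≤ 1`,
  `n ≥ 12` (from `Complex.exp_bound'`), which turns every matrix entry of file IV into a polynomial in `π`.

Everything is stated for functions with explicit `MemLp` witnesses (no auxiliary definitions: proof-only file).
No facts, no axioms; Mathlib only.
-/

set_option linter.dupNamespace false  -- the mandated namespace repeats `RiemannHypothesis`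

noncomputable section

open MeasureTheory Complex Set Finset
open scoped Real ComplexConjugate InnerProductSpace FourierTransform

namespace Summit.RiemannHypothesis.RiemannHypothesis.BandEnergy

/-! ## Inner products and norms of function classes in `L²(μ)` -/

section L2

variable {α : Type*} [MeasurableSpace α] {μ : Measure α}

/-- `⟪[e], [g]⟫ = ∫ conj e · g` for `L²` classes of functions. [folklore] -/
theorem inner_toLp_toLp {e g : α → ℂ} (he : MemLp e 2 μ) (hg : MemLp g 2 μ) :
    ⟪he.toLp e, hg.toLp g⟫_ℂ = ∫ x, conj (e x) * g x ∂μ := by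
  rw [L2.inner_def]
  refine integral_congr_ae ?_
  filter_upwards [he.coeFn_toLp, hg.coeFn_toLp] with x hx hy
  rw [hx, hy, RCLike.inner_apply']

/-- `‖[g]‖² = ∫ ‖g‖²` for an `L²` class. [folklore] -/
theorem norm_toLp_sq {g : α → ℂ} (hg : MemLp g 2 μ) : ‖hg.toLp g‖ ^ 2 = ∫ x, ‖g x‖ ^ 2 ∂μ := by
  rw [← inner_self_eq_norm_sq (𝕜 := ℂ), inner_toLp_toLp hg hg]
  have h : ∀ x, conj (g x) * g x = ((‖g x‖ ^ 2 : ℝ) : ℂ) := fun x => by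
    rw [Complex.conj_mul', Complex.ofReal_pow]
  simp_rw [h]
  rw [integral_complex_ofReal]
  simp only [RCLike.re_to_complex, Complex.ofReal_re]

end L2

/-! ## The interval `[−1, 1]`, the vectors `e_ξ(x) = e^{2πixξ}` and the Fourier transform -/

/-- A function continuous on `ℝ` is in every `L^p` of Lebesgue measure restricted to `[a, b]`. [folklore] -/
theorem memLp_restrict_Icc_of_continuous {g : ℝ → ℂ} (hg : Continuous g) (p : ENNReal) (a b : ℝ) :
    MemLp g p ((volume : Measure ℝ).restrict (Icc a b)) := by
  obtain ⟨C, hC⟩ := (isCompact_Icc (a := a) (b := b)).exists_bound_of_continuousOn hg.continuousOn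
  exact MemLp.of_bound hg.aestronglyMeasurable C
    ((ae_restrict_iff' measurableSet_Icc).2 (Filter.Eventually.of_forall fun x hx => hC x hx))

/-- The exponential `x ↦ e^{2πixξ}` is continuous. [folklore] -/
theorem continuous_expKernel (ξ : ℝ) : Continuous fun x : ℝ => cexp (↑(2 * π * x * ξ) * I) := by
  fun_prop

/-- `x ↦ e^{2πixξ}` is in `L²[a, b]`. [folklore] -/
theorem memLp_expKernel (ξ a b : ℝ) :
    MemLp (fun x : ℝ => cexp (↑(2 * π * x * ξ) * I)) 2 ((volume : Measure ℝ).restrict (Icc a b)) :=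
  memLp_restrict_Icc_of_continuous (continuous_expKernel ξ) 2 a b

/-- `‖e_ξ‖² = 2` in `L²[−1, 1]`. [folklore] -/
theorem norm_expVec_sq (ξ : ℝ) (he : MemLp (fun x : ℝ => cexp (↑(2 * π * x * ξ) * I)) 2
      ((volume : Measure ℝ).restrict (Icc (-1 : ℝ) 1))) :
    ‖he.toLp _‖ ^ 2 = 2 := by
  rw [norm_toLp_sq he]
  have h : ∀ x : ℝ, ‖cexp (↑(2 * π * x * ξ) * I)‖ ^ 2 = (1 : ℝ) := fun x => by
    rw [Complex.norm_exp_ofReal_mul_I, one_pow]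
  simp_rw [h]
  rw [integral_const, smul_eq_mul, mul_one, Measure.real, Measure.restrict_apply_univ, Real.volume_Icc]
  norm_num

/-- For `g = 0` a.e. off `[−1, 1]`: `𝓕 g ξ = ∫_{[−1,1]} e^{−2πixξ} g(x) dx`. [folklore] -/
theorem fourier_eq_setIntegral_Icc {g : ℝ → ℂ} (hg0 : ∀ᵐ x : ℝ, x ∉ Icc (-1 : ℝ) 1 → g x = 0) (ξ : ℝ) :
    𝓕 g ξ = ∫ x in Icc (-1 : ℝ) 1, cexp (↑(-2 * π * x * ξ) * I) * g x := by
  rw [Real.fourier_real_eq_integral_exp_smul]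
  simp only [smul_eq_mul]
  refine (setIntegral_eq_integral_of_ae_compl_eq_zero ?_).symm
  filter_upwards [hg0] with x hx hxs
  rw [hx hxs, mul_zero]

/-- `⟪e_ξ, [g]⟫ = ∫_{[−1,1]} e^{−2πixξ} g(x) dx` in `L²[−1, 1]`. [folklore] -/
theorem inner_expVec_toLp (ξ : ℝ) (he : MemLp (fun x : ℝ => cexp (↑(2 * π * x * ξ) * I)) 2
      ((volume : Measure ℝ).restrict (Icc (-1 : ℝ) 1))) {g : ℝ → ℂ}
    (hg : MemLp g 2 ((volume : Measure ℝ).restrict (Icc (-1 : ℝ) 1))) :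
    ⟪he.toLp _, hg.toLp g⟫_ℂ = ∫ x in Icc (-1 : ℝ) 1, cexp (↑(-2 * π * x * ξ) * I) * g x := by
  rw [inner_toLp_toLp he hg]
  refine integral_congr_ae (Filter.Eventually.of_forall fun x => ?_)
  simp only
  rw [← Complex.exp_conj, map_mul, Complex.conj_ofReal, Complex.conj_I]
  congr 1
  push_cast
  ring

/-- **The band energy is `∫ |⟪e_ξ, [f]⟫|²`**: for `f = 0` a.e. off `[−1, 1]` with `f ∈ L²[−1,1]`,
`⟪e_ξ, [f]⟫ = 𝓕 f ξ`. [folklore] -/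
theorem inner_expVec_toLp_eq_fourier (ξ : ℝ) (he : MemLp (fun x : ℝ => cexp (↑(2 * π * x * ξ) * I)) 2
      ((volume : Measure ℝ).restrict (Icc (-1 : ℝ) 1))) {f : ℝ → ℂ}
    (hf : MemLp f 2 ((volume : Measure ℝ).restrict (Icc (-1 : ℝ) 1)))
    (hf0 : ∀ᵐ x : ℝ, x ∉ Icc (-1 : ℝ) 1 → f x = 0) :
    ⟪he.toLp _, hf.toLp f⟫_ℂ = 𝓕 f ξ := by
  rw [inner_expVec_toLp ξ he hf, fourier_eq_setIntegral_Icc hf0]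

/-- `‖[f]‖²_{L²[−1,1]} = ∫_ℝ ‖f‖²` for `f = 0` a.e. off `[−1, 1]`. [folklore] -/
theorem norm_toLp_restrict_sq_eq {f : ℝ → ℂ} (hf : MemLp f 2 ((volume : Measure ℝ).restrict (Icc (-1 : ℝ) 1)))
    (hf0 : ∀ᵐ x : ℝ, x ∉ Icc (-1 : ℝ) 1 → f x = 0) :
    ‖hf.toLp f‖ ^ 2 = ∫ x, ‖f x‖ ^ 2 := by
  rw [norm_toLp_sq hf]
  refine setIntegral_eq_integral_of_ae_compl_eq_zero ?_
  filter_upwards [hf0] with x hx hxs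
  rw [hx hxs, norm_zero, zero_pow two_ne_zero]

/-- The partial Fourier integral `ξ ↦ ∫_{[−1,1]} e^{−2πixξ} g(x) dx` of `g ∈ L¹[−1,1]` is continuous (it is the
Fourier integral of `1_{[−1,1]} g ∈ L¹(ℝ)`). [folklore] -/
theorem continuous_setIntegral_fourierKernel {g : ℝ → ℂ} (hg : IntegrableOn g (Icc (-1 : ℝ) 1)) :
    Continuous fun ξ : ℝ => ∫ x in Icc (-1 : ℝ) 1, cexp (↑(-2 * π * x * ξ) * I) * g x := by
  have h0 : ∀ᵐ x : ℝ, x ∉ Icc (-1 : ℝ) 1 → (Icc (-1 : ℝ) 1).indicator g x = 0 :=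
    Filter.Eventually.of_forall fun x hx => Set.indicator_of_notMem hx g
  have h1 : ∀ ξ, (∫ x in Icc (-1 : ℝ) 1, cexp (↑(-2 * π * x * ξ) * I) * g x)
      = 𝓕 ((Icc (-1 : ℝ) 1).indicator g) ξ := fun ξ => by
    rw [fourier_eq_setIntegral_Icc h0]
    refine setIntegral_congr_fun measurableSet_Icc fun x hx => ?_
    simp only [Set.indicator_of_mem hx]
  simp_rw [h1]
  exact VectorFourier.fourierIntegral_continuous Real.continuous_fourierChar (by fun_prop)
    (hg.integrable_indicator measurableSet_Icc)

/-! ## The Taylor step under the integral sign -/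

/-- `2π ≤ 13/2`. [folklore] -/
theorem two_pi_le : 2 * π ≤ 13 / 2 := by
  have := Real.pi_lt_d2; linarith

/-- **Taylor step.**  For `g ∈ L¹[−1,1]`, `|ξ| ≤ 1` and `n ≥ 12`:
`‖∫_{[−1,1]} e^{−2πixξ} g − Σ_{k<n} ((−2πiξ)^k / k!) ∫_{[−1,1]} x^k g‖ ≤ 2 (2π)^n / n! · ∫_{[−1,1]} ‖g‖`
(`Complex.exp_bound'` with `‖2πixξ‖ ≤ 2π ≤ (n+1)/2`). [folklore] -/
theorem norm_setIntegral_fourierKernel_sub_taylor_le {g : ℝ → ℂ} (hg : IntegrableOn g (Icc (-1 : ℝ) 1))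
    {ξ : ℝ} (hξ : |ξ| ≤ 1) {n : ℕ} (hn : 12 ≤ n) :
    ‖(∫ x in Icc (-1 : ℝ) 1, cexp (↑(-2 * π * x * ξ) * I) * g x)
        - ∑ k ∈ range n, (↑(-2 * π * ξ) * I) ^ k / (k.factorial : ℂ)
            * ∫ x in Icc (-1 : ℝ) 1, (x : ℂ) ^ k * g x‖
      ≤ 2 * (2 * π) ^ n / n.factorial * ∫ x in Icc (-1 : ℝ) 1, ‖g x‖ := by
  set z : ℂ := ↑(-2 * π * ξ) * I with hz
  have hzn : ‖z‖ ≤ 2 * π := by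
    rw [hz, norm_mul, Complex.norm_I, mul_one, Complex.norm_real, Real.norm_eq_abs]
    rw [show -2 * π * ξ = -(2 * π * ξ) by ring, abs_neg, abs_mul, abs_of_pos Real.two_pi_pos]
    nlinarith [Real.pi_pos]
  -- each term `x ↦ (x z)^k / k! * g x` and the exponential term are integrable on `[−1,1]`
  have hIk : ∀ k : ℕ, IntegrableOn (fun x : ℝ => (x : ℂ) ^ k * g x) (Icc (-1 : ℝ) 1) := fun k =>
    IntegrableOn.continuousOn_mul (by fun_prop) hg isCompact_Icc
  have hIe : IntegrableOn (fun x : ℝ => cexp (↑(-2 * π * x * ξ) * I) * g x) (Icc (-1 : ℝ) 1) :=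
    IntegrableOn.continuousOn_mul (by fun_prop) hg isCompact_Icc
  have hIs : IntegrableOn (fun x : ℝ => (∑ k ∈ range n, ((x : ℂ) * z) ^ k / (k.factorial : ℂ)) * g x)
      (Icc (-1 : ℝ) 1) :=
    IntegrableOn.continuousOn_mul (by fun_prop) hg isCompact_Icc
  -- rewrite the finite sum of integrals as one integral
  have hsum : ∑ k ∈ range n, z ^ k / (k.factorial : ℂ) * ∫ x in Icc (-1 : ℝ) 1, (x : ℂ) ^ k * g x
      = ∫ x in Icc (-1 : ℝ) 1, (∑ k ∈ range n, ((x : ℂ) * z) ^ k / (k.factorial : ℂ)) * g x := by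
    have hc : ∀ k ∈ range n, z ^ k / (k.factorial : ℂ) * ∫ x in Icc (-1 : ℝ) 1, (x : ℂ) ^ k * g x
        = ∫ x in Icc (-1 : ℝ) 1, z ^ k / (k.factorial : ℂ) * ((x : ℂ) ^ k * g x) :=
      fun k _ => (integral_const_mul _ _).symm
    rw [Finset.sum_congr rfl hc, ← integral_finsetSum _ fun k _ => (hIk k).const_mul (z ^ k / (k.factorial : ℂ))]
    refine integral_congr_ae (Filter.Eventually.of_forall fun x => ?_)
    simp only
    rw [Finset.sum_mul]
    exact Finset.sum_congr rfl fun k _ => by rw [mul_pow]; ring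
  have hexp : ∀ x : ℝ, cexp (↑(-2 * π * x * ξ) * I) = cexp ((x : ℂ) * z) := fun x => by
    rw [hz]; congr 1; push_cast; ring
  rw [hsum, ← integral_sub hIe hIs]
  -- pointwise bound of the integrand
  have hpt : ∀ x ∈ Icc (-1 : ℝ) 1,
      ‖cexp (↑(-2 * π * x * ξ) * I) * g x - (∑ k ∈ range n, ((x : ℂ) * z) ^ k / (k.factorial : ℂ)) * g x‖
        ≤ 2 * (2 * π) ^ n / n.factorial * ‖g x‖ := by
    intro x hx
    have hx1 : |x| ≤ 1 := abs_le.2 ⟨by linarith [hx.1], hx.2⟩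
    have hxz : ‖(x : ℂ) * z‖ ≤ 2 * π := by
      rw [norm_mul, Complex.norm_real, Real.norm_eq_abs]
      calc |x| * ‖z‖ ≤ 1 * (2 * π) := by gcongr
        _ = 2 * π := one_mul _
    have hcond : ‖(x : ℂ) * z‖ / (n.succ : ℕ) ≤ 1 / 2 := by
      rw [div_le_iff₀ (by positivity)]
      have h13 : (13 : ℝ) ≤ (n.succ : ℕ) := by
        have : (13 : ℝ) ≤ (n : ℝ) + 1 := by exact_mod_cast Nat.succ_le_succ hn
        simpa using this
      linarith [two_pi_le]
    have hb := Complex.exp_bound' (x := (x : ℂ) * z) (n := n) hcond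
    rw [hexp x, ← sub_mul, norm_mul]
    calc ‖cexp ((x : ℂ) * z) - ∑ k ∈ range n, ((x : ℂ) * z) ^ k / (k.factorial : ℂ)‖ * ‖g x‖
        ≤ ‖(x : ℂ) * z‖ ^ n / n.factorial * 2 * ‖g x‖ := by gcongr
      _ ≤ (2 * π) ^ n / n.factorial * 2 * ‖g x‖ := by gcongr
      _ = 2 * (2 * π) ^ n / n.factorial * ‖g x‖ := by ring
  calc ‖∫ x in Icc (-1 : ℝ) 1, (cexp (↑(-2 * π * x * ξ) * I) * g x
          - (∑ k ∈ range n, ((x : ℂ) * z) ^ k / (k.factorial : ℂ)) * g x)‖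
      ≤ ∫ x in Icc (-1 : ℝ) 1, ‖cexp (↑(-2 * π * x * ξ) * I) * g x
          - (∑ k ∈ range n, ((x : ℂ) * z) ^ k / (k.factorial : ℂ)) * g x‖ :=
        norm_integral_le_integral_norm _
    _ ≤ ∫ x in Icc (-1 : ℝ) 1, 2 * (2 * π) ^ n / n.factorial * ‖g x‖ := by
        refine setIntegral_mono_on (hIe.sub hIs).norm (hg.norm.const_mul _) measurableSet_Icc hpt
    _ = 2 * (2 * π) ^ n / n.factorial * ∫ x in Icc (-1 : ℝ) 1, ‖g x‖ := integral_const_mul _ _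

end Summit.RiemannHypothesis.RiemannHypothesis.BandEnergy
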